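import Literature.Computability.AlgebraicComplexity.PlethysmStability
import Literature.Computability.Complexity.OccurrenceObstructionsHooks
import HarnessLib

/-!
# Plethysm stability for BIP: Props. 5.6(2), 5.8(2) discharged; Thm. 1.4 from Prop. 7.3 alone

Topic `Literature/Computability/Complexity` (route Literature.PNP.no_occurrence_obstructions), conventions
of `OccurrenceObstructionsBIP.lean`: `V = ℂ^{N×N}` with the lexicographically ordered matrix
variables `MatIdx N`, `ℂ[Sym^n V^*] = MvPolynomial (DegIdx (MatIdx N) n) ℂ` with the representation
`coordRep`, "λ occurs" = `HasHighestWeight _ (partitionWeightLex N λ)` (the dual weight `λ^*`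
transported to `MatIdx N`), `topMatIdx N` the greatest index (BIP's `e_1`), `secondPart λ = λ₂`,
`bodySize λ = |λ̄|`, `innerLift` the dual inner degree lifting (BIP's `κ`), `topDegIdx N s` the
coordinate of `x_{top}^s` (BIP's `e_1^s`).

Source: P. Bürgisser, C. Ikenmeyer, G. Panova, *No occurrence obstructions in geometric complexity
theory*, J. AMS 32 (2019) = arXiv:1604.06431v3, §5 Props. 5.6(2), 5.8(2) (statements quoted on the
two discharges below), proved in print from Prop. 4.5 (tableau generators `v_T` of
`HWV_λ(Sym^d Sym^n V)`), Thm. 5.5 / Lemma 5.7 (liftings of the `v_T`) and Lemma 4.3. This file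
DISCHARGES the two named facts `Literature.Computability.Complexity.bip2019_prop_5_6_2`, `Literature.Computability.Complexity.bip2019_prop_5_8_2` of
`OccurrenceObstructionsBIP.lean`:

* `bip2019_prop_5_6_2_holds`, `bip2019_prop_5_8_2_holds`,

from the support theorems of `Literature/Computability/AlgebraicComplexity/PlethysmStability.lean`
(Prop. 3.3 in polytabloid-basis form, the wreath symmetriser and Lemma 4.3(1), transport of
highest-weight vectors of `ℂ[Sym^n]_d` to the word model of `V^{⊗dn}` by full polarisation), plus
the partition bookkeeping `λ ↦ (λ₁ - r, λ₂, …)` (`lowerTop`: "`μ̄ = λ̄` and `λ = μ♯dn`") in the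
`partitionWeightLex` conventions. Consequences recorded here:

* `bip2019_prop_2_4_holds`, `bip2019_prop_6_1_holds` — BIP Props. 2.4 and 6.1 unconditionally
  (the tree's `…_of_parts` assemblies fed with the two discharges);
* `bip2019_no_occurrence_obstructions_of_thm_6_2`, `no_occurrence_obstructions_succ_of_thm_6_2`,
  `not_occurrenceObstructionRoute_of_thm_6_2` — BIP Thm. 1.4 (BIP padding, `n^25`), the
  fresh-variable statement at `(n+1)^25`, and the route consequence, from the named fact
  `bip2019_thm_6_2` (BIP Thm. 6.2) alone, the BLMW lift being discharged in `Polarization.lean`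
  (`CplxAlg.hasHighestWeight_coordRep_of_orbitCoordRep_holds`); and, through
  `bip2019_thm_6_2_of_prop_7_3` (`OccurrenceObstructionsHooks.lean`),
  `bip2019_no_occurrence_obstructions_of_prop_7_3`, `no_occurrence_obstructions_succ_of_prop_7_3`,
  `not_occurrenceObstructionRoute_of_prop_7_3` — the same three statements from the SINGLE
  remaining named fact `bip2019_prop_7_3` (BIP Prop. 7.3: positivity of the plethysm coefficients
  `a_ν(d[n])` of the hook-like shapes, the explicit tableau constructions of §7).

## References

* P. Bürgisser, C. Ikenmeyer, G. Panova, *No occurrence obstructions in geometric complexity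
  theory*, J. AMS 32 (2019) = arXiv:1604.06431v3: §2(a) (`λ♯D`, `λ̄`), §3(b), §4(a) Prop. 4.5,
  Lemma 4.3, §5(b) Lemma 5.3, Prop. 5.6, §5(c) (5.8), Prop. 5.8, §6 (Proof of Theorem 1.4),
  Thm. 6.2, §7. [key `BurgisserIkenmeyerPanovaJAMS2019`]

## Mathlib and tree

Mathlib: `Nat.Partition` (`parts`, `sortedParts`), `Multiset.sort_cons`, `Multiset.cons_erase`,
`Multiset.erase_cons_head`, `Fin.revPerm`/`Fin.rev`, `NeZero.mul`. Tree: everything of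
`PlethysmStability.lean` and `OccurrenceObstructionsBIP.lean` named in the proofs
(`secondPart`, `bodySize`, `sup_parts_eq_getD_sortedParts`, `sum_erase_sup_eq_bodySize`,
`secondPart_add_sup_le`, `X_mem_highestWeightSpace_coordRep`, `bip2019_prop_2_4_of_parts`,
`bip2019_prop_6_1_of_parts`, `bip2019_no_occurrence_obstructions_of_stability'`,
`no_occurrence_obstructions_succ_of_stability'`, `not_occurrenceObstructionRoute_of_succ`).
-/

open scoped BigOperators

namespace Literature.Computability.Complexity

open Finset

section LowerTop

variable {D : ℕ}

/-- The sorted parts of a nonempty partition: the largest part followed by the sorted body.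
[folklore] -/
theorem sortedParts_eq_cons (lam : Nat.Partition D) (h : lam.parts ≠ 0) :
    lam.sortedParts = lam.parts.sup :: (lam.parts.erase lam.parts.sup).sort (· ≥ ·) := by
  have hcons : lam.parts = lam.parts.sup ::ₘ lam.parts.erase lam.parts.sup :=
    (Multiset.cons_erase (sup_mem_of_ne_zero h)).symm
  change lam.parts.sort (· ≥ ·) = _
  conv_lhs => rw [hcons]
  exact Multiset.sort_cons _ _ _ (fun b hb => Multiset.le_sup (Multiset.mem_of_mem_erase hb))

/-- The `sup` of a multiset of naturals is the head of its decreasing sort. [folklore] -/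
theorem sup_eq_getD_sort_zero (s : Multiset ℕ) : s.sup = (s.sort (· ≥ ·)).getD 0 0 := by
  by_cases hs : s = 0
  · subst hs; simp
  · have hcons : s = s.sup ::ₘ s.erase s.sup := (Multiset.cons_erase (sup_mem_of_ne_zero hs)).symm
    conv_rhs => rw [hcons, Multiset.sort_cons _ _ _ (fun b hb => Multiset.le_sup (Multiset.mem_of_mem_erase hb))]
    rfl

/-- **`λ₂` is the second row**: `secondPart λ = λ.sortedParts[1]` (zero-padded), reconciling
the BIP file's `secondPart` (largest element of the body) with the Young-diagram row length
`rowLen 1` used by the polytabloid theory. [cite: BurgisserIkenmeyerPanovaJAMS2019, §3(b) (partitions as Young diagrams)] -/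
theorem secondPart_eq_getD_sortedParts_one (lam : Nat.Partition D) :
    secondPart lam = lam.sortedParts.getD 1 0 := by
  by_cases h : lam.parts = 0
  · have : lam.sortedParts = [] := by
      change lam.parts.sort (· ≥ ·) = []
      rw [h, Multiset.sort_zero]
    rw [secondPart, h, this]
    simp
  · rw [sortedParts_eq_cons lam h, List.getD_cons_succ, secondPart, sup_eq_getD_sort_zero]

/-- `λ₁ + |λ̄| = |λ|`. [cite: BurgisserIkenmeyerPanovaJAMS2019, §2(a) (the body `λ̄`)] -/
theorem sup_add_bodySize (lam : Nat.Partition D) : lam.parts.sup + bodySize lam = D := by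
  have := sup_parts_le lam
  unfold bodySize
  omega

/-- **Shortening the first row.** For `λ ⊢ D` and `r` with `λ₂ + r ≤ λ₁`, the partition
`μ = (λ₁ - r, λ₂, λ₃, …) ⊢ D'`, `D' + r = D`, so that `μ̄ = λ̄` and `λ = μ♯D` (BIP §2(a): "`λ♯D`
arises from `λ` by extending the first row"; proof of Prop. 5.6(2): "We can therefore shorten the
given `λ` to a partition `μ ⊢ md` by removing singleton columns. Then `μ̄ = λ̄` and `λ = μ♯dn`").
As a multiset: the body of `λ` together with the part `λ₁ - r` if it is nonzero.
[cite: BurgisserIkenmeyerPanovaJAMS2019, Prop. 5.6 (2) (proof)] -/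
def lowerTop (lam : Nat.Partition D) (r D' : ℕ) (hD : D' + r = D)
    (hr : secondPart lam + r ≤ lam.parts.sup) : Nat.Partition D' where
  parts := lam.parts.erase lam.parts.sup +
    if lam.parts.sup = r then 0 else {lam.parts.sup - r}
  parts_pos {i} hi := by
    rcases Multiset.mem_add.mp hi with hi | hi
    · exact lam.parts_pos (Multiset.mem_of_mem_erase hi)
    · split_ifs at hi with h
      · exact absurd hi (Multiset.notMem_zero _)
      · rw [Multiset.mem_singleton] at hi
        subst hi
        omega
  parts_sum := by
    rw [Multiset.sum_add, sum_erase_sup_eq_bodySize]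
    have h1 := sup_add_bodySize lam
    split_ifs with h
    · rw [Multiset.sum_zero]; omega
    · rw [Multiset.sum_singleton]; omega

variable (lam : Nat.Partition D) (r D' : ℕ) (hD : D' + r = D) (hr : secondPart lam + r ≤ lam.parts.sup)

/-- The parts of the shortened partition (unfolding lemma). [folklore] -/
theorem lowerTop_parts : (lowerTop lam r D' hD hr).parts = lam.parts.erase lam.parts.sup +
    if lam.parts.sup = r then 0 else {lam.parts.sup - r} := rfl

include hr in
/-- If the whole first row is removed (`λ₁ = r`, so `λ₂ = 0`) then the body is empty. [folklore] -/
theorem erase_sup_eq_zero_of_sup_eq (h : lam.parts.sup = r) : lam.parts.erase lam.parts.sup = 0 := by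
  have h2 : secondPart lam = 0 := by omega
  rw [Multiset.eq_zero_iff_forall_notMem]
  intro a ha
  have hpos := lam.parts_pos (Multiset.mem_of_mem_erase ha)
  have hle : a ≤ secondPart lam := Multiset.le_sup ha
  omega

/-- Shortening the first row does not increase the number of parts. [folklore] -/
theorem card_parts_lowerTop_le : (lowerTop lam r D' hD hr).parts.card ≤ lam.parts.card := by
  rw [lowerTop_parts, Multiset.card_add]
  by_cases h0 : lam.parts = 0
  · have hs : lam.parts.sup = 0 := by rw [h0]; rfl
    have hr0 : r = 0 := by have := hr; rw [hs] at this; omega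
    rw [if_pos (hs.trans hr0.symm), h0]
    simp
  · have hcard : (lam.parts.erase lam.parts.sup).card + 1 = lam.parts.card :=
      Multiset.card_erase_add_one (sup_mem_of_ne_zero h0)
    split_ifs
    · rw [Multiset.card_zero]; omega
    · rw [Multiset.card_singleton]; omega

/-- The first row of the shortened partition is `λ₁ - r`. [folklore] -/
theorem sup_parts_lowerTop : (lowerTop lam r D' hD hr).parts.sup = lam.parts.sup - r := by
  rw [lowerTop_parts]
  split_ifs with h
  · rw [erase_sup_eq_zero_of_sup_eq lam r hr h, h]
    simp
  · rw [Multiset.sup_add, Multiset.sup_singleton]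
    apply max_eq_right
    exact Multiset.sup_le.mpr fun b hb => by
      have : b ≤ secondPart lam := Multiset.le_sup hb
      omega

/-- **The body is unchanged**: `μ̄ = λ̄` for `μ` the shortened partition (BIP Prop. 5.6(2):
"`μ ⊢ md` such that `μ̄ = λ̄`"). [cite: BurgisserIkenmeyerPanovaJAMS2019, Prop. 5.6 (2)] -/
theorem erase_sup_lowerTop : (lowerTop lam r D' hD hr).parts.erase (lowerTop lam r D' hD hr).parts.sup =
    lam.parts.erase lam.parts.sup := by
  rw [sup_parts_lowerTop, lowerTop_parts]
  split_ifs with h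
  · rw [erase_sup_eq_zero_of_sup_eq lam r hr h]
    simp
  · rw [add_comm, Multiset.singleton_add, Multiset.erase_cons_head]

/-- The rows of the shortened partition: `λ₁ - r, λ₂, λ₃, …`. [folklore] -/
theorem getD_sortedParts_lowerTop (i : ℕ) : (lowerTop lam r D' hD hr).sortedParts.getD i 0 =
    if i = 0 then lam.sortedParts.getD 0 0 - r else lam.sortedParts.getD i 0 := by
  have hsup0 : lam.parts.sup = lam.sortedParts.getD 0 0 := sup_parts_eq_getD_sortedParts lam
  by_cases h : lam.parts.sup = r
  · -- body empty: λ = (r) or empty, μ = empty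
    have hE := erase_sup_eq_zero_of_sup_eq lam r hr h
    have hμ : (lowerTop lam r D' hD hr).parts = 0 := by rw [lowerTop_parts, if_pos h, hE, zero_add]
    have hμs : (lowerTop lam r D' hD hr).sortedParts = [] := by
      change (lowerTop lam r D' hD hr).parts.sort (· ≥ ·) = []; rw [hμ, Multiset.sort_zero]
    rw [hμs, List.getD_nil]
    by_cases h0 : lam.parts = 0
    · have : lam.sortedParts = [] := by change lam.parts.sort (· ≥ ·) = []; rw [h0, Multiset.sort_zero]
      rw [this]; simp
    · rw [sortedParts_eq_cons lam h0, hE, Multiset.sort_zero]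
      split_ifs with hi
      · subst hi; simp [h]
      · obtain ⟨i', rfl⟩ : ∃ i', i = i' + 1 := ⟨i - 1, by omega⟩
        simp
  · have h0 : lam.parts ≠ 0 := by
      intro h0; apply h
      have hs : lam.parts.sup = 0 := by rw [h0]; rfl
      have := hr; rw [hs] at this; omega
    have hμ : (lowerTop lam r D' hD hr).parts = (lam.parts.sup - r) ::ₘ lam.parts.erase lam.parts.sup := by
      rw [lowerTop_parts, if_neg h, add_comm, Multiset.singleton_add]
    have hμs : (lowerTop lam r D' hD hr).sortedParts =
        (lam.parts.sup - r) :: (lam.parts.erase lam.parts.sup).sort (· ≥ ·) := by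
      change (lowerTop lam r D' hD hr).parts.sort (· ≥ ·) = _
      rw [hμ]
      exact Multiset.sort_cons _ _ _ fun b hb => by
        have : b ≤ secondPart lam := Multiset.le_sup hb
        omega
    rw [hμs, sortedParts_eq_cons lam h0]
    split_ifs with hi
    · subst hi; simp
    · obtain ⟨i', rfl⟩ : ∃ i', i = i' + 1 := ⟨i - 1, by omega⟩
      simp

/-- The weight of the shortened partition in `GL_M` is `(λ₁ - r, λ₂, …) = λ - r ε_0`. [folklore] -/
theorem ofPartition_lowerTop (M : ℕ) [NeZero M] :
    Literature.NumberTheory.DiophantineGeometry.Weight.ofPartition M (lowerTop lam r D' hD hr) =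
      Literature.NumberTheory.DiophantineGeometry.Weight.ofPartition M lam - Pi.single 0 (r : ℤ) := by
  funext i
  rw [Pi.sub_apply, Literature.NumberTheory.DiophantineGeometry.Weight.ofPartition_apply, Literature.NumberTheory.DiophantineGeometry.Weight.ofPartition_apply,
    getD_sortedParts_lowerTop]
  have hsup0 : lam.parts.sup = lam.sortedParts.getD 0 0 := sup_parts_eq_getD_sortedParts lam
  by_cases hi : i = 0
  · subst hi
    rw [Fin.val_zero, if_pos rfl, Pi.single_eq_same]
    have : r ≤ lam.sortedParts.getD 0 0 := by rw [← hsup0]; have := hr; omega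
    push_cast [Nat.cast_sub this]
    ring
  · have hi' : (i : ℕ) ≠ 0 := fun h => hi (Fin.ext h)
    rw [if_neg hi', Pi.single_eq_of_ne hi, sub_zero]

/-- **The weight of the shortened partition in the matrix/dual convention**:
`μ^* = λ^* + r ε_{top}` (the dual weight has `-λ₁` at the greatest index). This is the weight
shift of the inner lifting by `r/d` (Lemma 5.3, in the dual form `innerLift_mem_highestWeightSpace`
of `PlethysmLifting.lean`) and of multiplication by `X_{x_top^s}^{r/s}` (§5(c)).
[cite: BurgisserIkenmeyerPanovaJAMS2019, Lemma 5.3] -/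
theorem partitionWeightLex_lowerTop (N : ℕ) [NeZero N] :
    partitionWeightLex N (lowerTop lam r D' hD hr) =
      partitionWeightLex N lam + Pi.single (topMatIdx N) (r : ℤ) := by
  funext x
  obtain ⟨i, rfl⟩ := (Literature.NumberTheory.DiophantineGeometry.matIdxEquiv N).surjective x
  rw [partitionWeightLex, partitionWeightLex, Pi.add_apply, Literature.NumberTheory.DiophantineGeometry.Weight.toMatIdx,
    Literature.NumberTheory.DiophantineGeometry.Weight.toMatIdx, OrderIso.symm_apply_apply, Literature.NumberTheory.DiophantineGeometry.Weight.dualOfPartition,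
    Literature.NumberTheory.DiophantineGeometry.Weight.dualOfPartition, Literature.NumberTheory.DiophantineGeometry.Weight.dual, Literature.NumberTheory.DiophantineGeometry.Weight.dual,
    ofPartition_lowerTop, Pi.sub_apply, neg_sub', sub_eq_add_neg, neg_neg]
  congr 1
  have htop : Literature.NumberTheory.DiophantineGeometry.matIdxEquiv N i = topMatIdx N ↔ Fin.rev i = 0 := by
    rw [topMatIdx, (Literature.NumberTheory.DiophantineGeometry.matIdxEquiv N).injective.eq_iff, Fin.ext_iff, Fin.ext_iff, Fin.val_rev]
    simp only [Fin.val_zero]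
    have := i.2
    omega
  by_cases h : Fin.rev i = 0
  · rw [h, Pi.single_eq_same, htop.mpr h, Pi.single_eq_same]
  · rw [Pi.single_eq_of_ne h, Pi.single_eq_of_ne (fun h' => h (htop.mp h'))]

end LowerTop

end Literature.Computability.Complexity


/-! ### BIP Props. 5.6(2) and 5.8(2) discharged -/

namespace Literature.Computability.Complexity

open MvPolynomial Finset

section Stability

/-- The order-reversing enumeration of the matrix indices, `i ↦` the `i`-th greatest index of
`MatIdx N` (lexicographic order), so that `0 ↦ topMatIdx N`, BIP's `e_1`/`X_1` in the dual,
greatest-index convention of `coordRep`. [cite: BurgisserIkenmeyerPanovaJAMS2019, §5(a)] -/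
def revMatIdx (N : ℕ) : Fin (N * N) ≃ Literature.NumberTheory.DiophantineGeometry.MatIdx N :=
  Fin.revPerm.trans (Literature.NumberTheory.DiophantineGeometry.matIdxEquiv N).toEquiv

/-- Unfolding lemma for `revMatIdx`. [folklore] -/
theorem revMatIdx_apply (N : ℕ) (i : Fin (N * N)) :
    revMatIdx N i = Literature.NumberTheory.DiophantineGeometry.matIdxEquiv N (Fin.rev i) := rfl

/-- `revMatIdx` is order-reversing. [folklore] -/
theorem strictAnti_revMatIdx (N : ℕ) : StrictAnti (revMatIdx N) := fun a b hab => by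
  rw [revMatIdx_apply, revMatIdx_apply]
  exact (Literature.NumberTheory.DiophantineGeometry.matIdxEquiv N).strictMono (Fin.rev_lt_rev.mpr hab)

/-- `revMatIdx N 0 = topMatIdx N` (the greatest matrix index, BIP's `e_1`). [cite: BurgisserIkenmeyerPanovaJAMS2019, §5(a)] -/
theorem revMatIdx_zero (N : ℕ) [NeZero N] : revMatIdx N 0 = topMatIdx N := by
  rw [revMatIdx_apply, topMatIdx]
  congr 1

/-- The weight `λ^*` of the coordinate-ring convention (`partitionWeightLex`) read through
`revMatIdx` and negated is `λ` itself: `-(λ^*)(i-th greatest index) = λ_{i+1}`. [folklore] -/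
theorem neg_partitionWeightLex_revMatIdx (N : ℕ) {D : ℕ} (lam : Nat.Partition D) (i : Fin (N * N)) :
    -(partitionWeightLex N lam) (revMatIdx N i) = Literature.NumberTheory.DiophantineGeometry.Weight.ofPartition (N * N) lam i := by
  rw [revMatIdx_apply, partitionWeightLex, Literature.NumberTheory.DiophantineGeometry.Weight.toMatIdx, OrderIso.symm_apply_apply,
    Literature.NumberTheory.DiophantineGeometry.Weight.dualOfPartition, Literature.NumberTheory.DiophantineGeometry.Weight.dual, neg_neg, Fin.rev_rev]

/-- **Discharge of `bip2019_prop_5_6_2` — BIP Prop. 5.6(2) (plethysm stability under the inner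
degree lifting).** "Suppose that `λ ⊢ nd` satisfies `λ₂ ≤ m` and `λ₂ + |λ̄| ≤ md`. Then every
highest weight vector of weight `λ` in `Sym^d Sym^n V` is obtained by lifting a highest weight
vector in `Sym^d Sym^m V` of weight `μ`, where `μ ⊢ md` such that `μ̄ = λ̄`." Proof (BIP §5(b),
dual picture of the fact's statement): by the support theorem
`CplxAlg.le_apply_add_of_mem_highestWeightSpace_coordRep` (Prop. 4.5 + Lemma 4.3(1): "each of the
`d` letters appears at least `n - λ₂ ≥ n - m` times in singleton columns") every coordinate `X_e`
occurring in `h` has `e(top) ≥ n - λ₂ ≥ n - m`, so `h = innerLift f` for the form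
`f = innerLower h` of degree `d` (`CplxAlg.innerLift_innerLower_of_forall_le`); `f` is a
highest-weight vector of weight `λ^* + (n-m)d ε_top` (`CplxAlg.mem_highestWeightSpace_of_innerLift_mem`,
Lemma 5.3 backwards), which is `μ^*` for `μ = (λ₁ - (n-m)d, λ₂, …) ⊢ md`
(`lowerTop`, `partitionWeightLex_lowerTop`; "`μ̄ = λ̄` and `λ = μ♯dn`", the condition
`λ₂ + |λ̄| ≤ md` being exactly `μ₁ ≥ μ₂`). [cite: BurgisserIkenmeyerPanovaJAMS2019, Prop. 5.6 (2)] -/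
theorem bip2019_prop_5_6_2_holds : bip2019_prop_5_6_2 := by
  intro N m' n' d _ hmn lam hlam h₂ hbody h hh hhw
  classical
  set iₘ := topMatIdx N with hiₘ'
  have hiₘ : ∀ i, i ≤ iₘ := le_topMatIdx N
  have hρ := strictAnti_revMatIdx N
  have hρ0 : revMatIdx N 0 = iₘ := revMatIdx_zero N
  have hχ : ∀ i, -(partitionWeightLex N lam) (revMatIdx N i) = Literature.NumberTheory.DiophantineGeometry.Weight.ofPartition (N * N) lam i :=
    neg_partitionWeightLex_revMatIdx N lam
  -- Step 1 (BIP Prop. 4.5 with Lemma 4.3(1)): every coordinate occurring in `h` has `e(iₘ) ≥ n' - λ₂`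
  have hsupp : ∀ s ∈ h.support, ∀ e ∈ s.support, n' - m' ≤ e.1 iₘ := by
    intro s hs e he
    have := AlgebraicComplexity.le_apply_add_of_mem_highestWeightSpace_coordRep hρ lam hlam hh hχ hhw hs he
    rw [hρ0, ← secondPart_eq_getD_sortedParts_one] at this
    omega
  -- Step 2: so `h` is an inner lifting
  set f := AlgebraicComplexity.innerLower iₘ m' n' h with hf'
  have hfh : AlgebraicComplexity.innerLift iₘ m' n' f = h :=
    AlgebraicComplexity.innerLift_innerLower_of_forall_le iₘ hmn hsupp
  have hf : f.IsHomogeneous d := AlgebraicComplexity.isHomogeneous_innerLower iₘ hh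
  -- Step 3: the weight of `f`
  have hfw : f ∈ Literature.NumberTheory.DiophantineGeometry.highestWeightSpace (AlgebraicComplexity.coordRep (Literature.NumberTheory.DiophantineGeometry.MatIdx N) ℂ m')
      (partitionWeightLex N lam + Pi.single iₘ ((((n' - m') * d : ℕ)) : ℤ)) :=
    AlgebraicComplexity.mem_highestWeightSpace_of_innerLift_mem iₘ hiₘ hmn hf (by rw [hfh]; exact hhw)
  -- Step 4: the partition `μ` (`λ` with `(n'-m')d` boxes removed from the first row)
  have hsum := sup_add_bodySize lam
  have hsplit : (n' - m') * d + m' * d = d * n' := by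
    rw [← add_mul, Nat.sub_add_cancel hmn, mul_comm]
  have hr : secondPart lam + (n' - m') * d ≤ lam.parts.sup := by omega
  have hD : d * m' + (n' - m') * d = d * n' := by rw [mul_comm d m']; omega
  refine ⟨lowerTop lam ((n' - m') * d) (d * m') hD hr, f,
    (card_parts_lowerTop_le _ _ _ _ _).trans hlam, erase_sup_lowerTop _ _ _ _ _, hf, ?_, hfh.symm⟩
  rw [partitionWeightLex_lowerTop]
  exact hfw

/-- **Discharge of `bip2019_prop_5_8_2` — BIP Prop. 5.8(2) (plethysm stability under the outer
degree lifting).** "Suppose that `f` is a highest weight vector in `Sym^d Sym^m V` of weight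
`μ ⊢ dm` and assume that `μ₂ + |μ̄| ≤ k ≤ d` for some `k`. Then `μ = ν♯dm` for some `ν ⊢ mk` and
`f = (e_1^m)^{d-k} · g` for some `g ∈ HWV_ν(Sym^k Sym^m V)`." Proof (BIP §5(c), dual picture): by
the support theorem `CplxAlg.le_apply_single_add_of_mem_highestWeightSpace_coordRep` (Prop. 4.5:
"there are at least `d - (ν₂ + |ν̄|) ≥ d - k` many letters appearing in singleton columns of `T''`
only") every monomial of `f` contains the coordinate `X_{x_top^m}` (the dual of `e_1^m`) at least
`d - k` times, so `f = X_{x_top^m}^{d-k} · g` (`CplxAlg.eq_X_pow_mul_of_le_apply`) with `g` a form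
of degree `k`; as `X_{x_top^m}` is a nonzero highest-weight vector of weight `-m ε_top`, `g` is a
highest-weight vector of weight `μ^* + (d-k)m ε_top = ν^*`, `ν = (μ₁ - (d-k)m, μ₂, …) ⊢ km`
(`CplxAlg.mem_highestWeightSpace_of_mul`, `lowerTop`). [cite: BurgisserIkenmeyerPanovaJAMS2019, Prop. 5.8 (2)] -/
theorem bip2019_prop_5_8_2_holds : bip2019_prop_5_8_2 := by
  intro N s d k' _ mu hmu hk hkd f hf hfw
  classical
  set iₘ := topMatIdx N with hiₘ'
  have hiₘ : ∀ i, i ≤ iₘ := le_topMatIdx N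
  have hρ := strictAnti_revMatIdx N
  have hρ0 : revMatIdx N 0 = iₘ := revMatIdx_zero N
  have hχ : ∀ i, -(partitionWeightLex N mu) (revMatIdx N i) = Literature.NumberTheory.DiophantineGeometry.Weight.ofPartition (N * N) mu i :=
    neg_partitionWeightLex_revMatIdx N mu
  set e₀ := topDegIdx N s with he₀'
  have hsum := sup_add_bodySize mu
  have hsup : mu.parts.sup = mu.sortedParts.getD 0 0 := sup_parts_eq_getD_sortedParts mu
  have hsec : secondPart mu = mu.sortedParts.getD 1 0 := secondPart_eq_getD_sortedParts_one mu
  -- Step 1 (BIP Prop. 4.5): every monomial of `f` contains `X_{e₀}` at least `d - k'` times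
  have hsupp : ∀ t ∈ f.support, d - k' ≤ t e₀ := by
    intro t ht
    have key := AlgebraicComplexity.le_apply_single_add_of_mem_highestWeightSpace_coordRep hρ mu hmu hf hχ hfw ht
    have he : (⟨Finsupp.single (revMatIdx N 0) s,
        AlgebraicComplexity.mem_degMonomials_iff.mpr (Finsupp.degree_single _ _)⟩ :
        AlgebraicComplexity.DegIdx (Literature.NumberTheory.DiophantineGeometry.MatIdx N) s) = e₀ := Subtype.ext (by rw [hρ0]; rfl)
    rw [he, ← hsup, ← hsec] at key
    omega
  -- Step 2: factor
  set g := ∑ t ∈ f.support, monomial (t - Finsupp.single e₀ (d - k')) (coeff t f) with hg'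
  have hfg : f = X e₀ ^ (d - k') * g := AlgebraicComplexity.eq_X_pow_mul_of_le_apply f e₀ (d - k') hsupp
  have hg : g.IsHomogeneous k' := by
    have := AlgebraicComplexity.isHomogeneous_sum_monomial_sub hf e₀ (d - k') hsupp
    rwa [Nat.sub_sub_self hkd] at this
  -- Step 3: the weight of `g`
  have hX : (X e₀ : MvPolynomial (AlgebraicComplexity.DegIdx (Literature.NumberTheory.DiophantineGeometry.MatIdx N) s) ℂ) ∈
      Literature.NumberTheory.DiophantineGeometry.highestWeightSpace (AlgebraicComplexity.coordRep (Literature.NumberTheory.DiophantineGeometry.MatIdx N) ℂ s) (Pi.single iₘ (-(s : ℤ))) :=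
    Complexity.X_mem_highestWeightSpace_coordRep s iₘ hiₘ e₀ rfl
  have hXp := AlgebraicComplexity.pow_mem_highestWeightSpace_coordRep hX (d - k')
  have hgw : g ∈ Literature.NumberTheory.DiophantineGeometry.highestWeightSpace (AlgebraicComplexity.coordRep (Literature.NumberTheory.DiophantineGeometry.MatIdx N) ℂ s)
      (partitionWeightLex N mu - (d - k') • Pi.single iₘ (-(s : ℤ))) :=
    AlgebraicComplexity.mem_highestWeightSpace_of_mul hXp (pow_ne_zero _ (X_ne_zero e₀)) (by rw [← hfg]; exact hfw)
  have hw : partitionWeightLex N mu - (d - k') • Pi.single iₘ (-(s : ℤ)) =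
      partitionWeightLex N mu + Pi.single iₘ ((((d - k') * s : ℕ)) : ℤ) := by
    funext j
    simp only [Pi.sub_apply, Pi.add_apply, Pi.smul_apply, Pi.single_apply]
    split_ifs <;> push_cast <;> ring
  rw [hw] at hgw
  -- Step 4: the partition `ν`
  have hsec' := secondPart_add_sup_le mu
  have hsplit : (d - k') * s + k' * s = d * s := by
    rw [← add_mul, Nat.sub_add_cancel hkd]
  have hr : secondPart mu + (d - k') * s ≤ mu.parts.sup := by
    rcases Nat.eq_zero_or_pos s with hs0 | hs0
    · subst hs0
      simp only [Nat.mul_zero] at hsum hsec' ⊢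
      omega
    · have : k' ≤ k' * s := Nat.le_mul_of_pos_right k' hs0
      omega
  have hD : k' * s + (d - k') * s = d * s := by omega
  refine ⟨lowerTop mu ((d - k') * s) (k' * s) hD hr, g,
    (card_parts_lowerTop_le _ _ _ _ _).trans hmu, erase_sup_lowerTop _ _ _ _ _, hg, ?_, hfg⟩
  rw [partitionWeightLex_lowerTop]
  exact hgw

/-! ### Consequences: Props. 2.4, 6.1 unconditionally; Thm. 1.4 from Thm. 6.2 alone -/

/-- **BIP Prop. 2.4 (small degrees), unconditionally**: the tree's
`bip2019_prop_2_4_of_parts` fed with `bip2019_prop_5_6_2_holds`. "Let `λ ⊢ nd` be such that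
there exists a positive integer `m` satisfying `|λ̄| ≤ md` and `md² ≤ n`. If `{λ^*}` occurs in
`Sym^d Sym^n V^*`, then `λ` occurs in `ℂ[Ω_n]_d`" (weight form, BIP padding conventions of
`OccurrenceObstructionsBIP.lean`). [cite: BurgisserIkenmeyerPanovaJAMS2019, Prop. 2.4] -/
theorem bip2019_prop_2_4_holds : bip2019_prop_2_4 :=
  bip2019_prop_2_4_of_parts bip2019_prop_5_6_2_holds

/-- **BIP Prop. 6.1 (extremely long first rows), unconditionally**: the tree's
`bip2019_prop_6_1_of_parts` fed with `bip2019_prop_5_6_2_holds` and `bip2019_prop_5_8_2_holds`.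
[cite: BurgisserIkenmeyerPanovaJAMS2019, Prop. 6.1] -/
theorem bip2019_prop_6_1_holds : bip2019_prop_6_1 :=
  bip2019_prop_6_1_of_parts bip2019_prop_5_6_2_holds bip2019_prop_5_8_2_holds

/-- **BIP Thm. 1.4 for BIP's padded permanent from Thm. 6.2 alone.** All other ingredients of
the printed proof are now theorems of the tree: Thm. 2.1 (Kadish–Landsberg bounds,
`bip2019_thm_2_1_holds`), Lemma 2.2 (semigroup), Prop. 2.3 (even rectangles, via Cayley's
hyperdeterminant), Prop. 2.4 and Prop. 6.1 (this file), Thm. 2.5 (padded power sums),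
Prop. 3.2 (power sums), Prop. 6.3 (splitting), the BLMW lift
(`CplxAlg.hasHighestWeight_coordRep_of_orbitCoordRep_holds`, `Polarization.lean`) and the
plethysm stability Props. 5.6(2), 5.8(2) (this file). What remains as a named fact is
Thm. 6.2, BIP's explicit tableau constructions of §7 (Props. 7.2, 7.3).
[cite: BurgisserIkenmeyerPanovaJAMS2019, Thm. 1.4 and §6 (Proof of Theorem 1.4)] -/
theorem bip2019_no_occurrence_obstructions_of_thm_6_2 (h62 : bip2019_thm_6_2) :
    bip2019_no_occurrence_obstructions :=
  bip2019_no_occurrence_obstructions_of_stability' bip2019_prop_5_6_2_holds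
    bip2019_prop_5_8_2_holds h62 fun _ => AlgebraicComplexity.hasHighestWeight_coordRep_of_orbitCoordRep_holds

/-- **The fresh-variable statement at threshold `(n+1)^25` (`no_occurrence_obstructions_succ`)
from Thm. 6.2 alone** (same assembly with `M = n + 1`). [cite: BurgisserIkenmeyerPanovaJAMS2019, §6 (Proof of Theorem 1.4), with M = n + 1] -/
theorem no_occurrence_obstructions_succ_of_thm_6_2 (h62 : bip2019_thm_6_2) :
    no_occurrence_obstructions_succ :=
  no_occurrence_obstructions_succ_of_stability' bip2019_prop_5_6_2_holds
    bip2019_prop_5_8_2_holds h62 fun _ => AlgebraicComplexity.hasHighestWeight_coordRep_of_orbitCoordRep_holds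

/-- **Consequence for the route statement**: `not_occurrenceObstructionRoute` (no occurrence
obstruction proves superpolynomial determinantal complexity of the padded permanent) follows from
Thm. 6.2 alone. [cite: BurgisserIkenmeyerPanovaJAMS2019, Thm. 1.4 (consequences, §1(a))] -/
theorem not_occurrenceObstructionRoute_of_thm_6_2 (h62 : bip2019_thm_6_2) :
    not_occurrenceObstructionRoute :=
  not_occurrenceObstructionRoute_of_succ (no_occurrence_obstructions_succ_of_thm_6_2 h62)

end Stability

end Literature.Computability.Complexity

namespace Literature.Computability.Complexity

section FromProp73

/-- **BIP Thm. 1.4 for BIP's padded permanent from Prop. 7.3 ALONE.** Every other ingredient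
of the printed proof is a theorem of the tree (Thm. 2.1, Lemma 2.2, Props. 2.3, 2.4, Thm. 2.5,
Prop. 3.2, Props. 5.6(2), 5.8(2), 6.1, 6.3, Thm. 6.2 from Prop. 7.3
(`OccurrenceObstructionsHooks.lean`), the BLMW lift); what remains as a named fact is the
positivity of the plethysm coefficients `a_ν(d[n])` for the hook-like shapes `ν`, BIP Prop. 7.3
(explicit tableaux, §7). [cite: BurgisserIkenmeyerPanovaJAMS2019, Thm. 1.4 and §6–§7] -/
theorem bip2019_no_occurrence_obstructions_of_prop_7_3 (h73 : bip2019_prop_7_3) :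
    bip2019_no_occurrence_obstructions :=
  bip2019_no_occurrence_obstructions_of_thm_6_2 (bip2019_thm_6_2_of_prop_7_3 h73)

/-- **The fresh-variable statement at threshold `(n+1)^25` from Prop. 7.3 alone.**
[cite: BurgisserIkenmeyerPanovaJAMS2019, §6 (Proof of Theorem 1.4), with M = n + 1] -/
theorem no_occurrence_obstructions_succ_of_prop_7_3 (h73 : bip2019_prop_7_3) :
    no_occurrence_obstructions_succ :=
  no_occurrence_obstructions_succ_of_thm_6_2 (bip2019_thm_6_2_of_prop_7_3 h73)

/-- **Consequence for the route statement from Prop. 7.3 alone.** [cite: BurgisserIkenmeyerPanovaJAMS2019, Thm. 1.4 (§1(a))] -/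
theorem not_occurrenceObstructionRoute_of_prop_7_3 (h73 : bip2019_prop_7_3) :
    not_occurrenceObstructionRoute :=
  not_occurrenceObstructionRoute_of_succ (no_occurrence_obstructions_succ_of_prop_7_3 h73)

end FromProp73

end Literature.Computability.Complexity
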